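import Summits.AtomisticToContinuum.HydrodynamicLimit.Theses.JParityClosure
import Literature.MathematicalPhysics.KineticTheory.CollisionTubeFunctional
import Literature.MathematicalPhysics.KineticTheory.EvenCollisionTubeFunctional
import Literature.MathematicalPhysics.KineticTheory.HardSphereEulerProofs
import Summits.AtomisticToContinuum.HydrodynamicLimit.Theorems.EvenStressEnskog.Negative.ContactValueZero
import Summits.AtomisticToContinuum.HydrodynamicLimit.Theorems.EvenStressEnskog.Negative.PairFunctionalVanishing
import Summits.AtomisticToContinuum.HydrodynamicLimit.Theorems.EvenStressEnskog.Negative.FrequencyLawReduction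
import Summits.AtomisticToContinuum.HydrodynamicLimit.Theorems.JParityClosureOddContactSymmetryL2ToProbability
import Summits.AtomisticToContinuum.HydrodynamicLimit.Theorems.JParityClosureEvenStressEnskogTubeStatRegular
import Summits.AtomisticToContinuum.HydrodynamicLimit.Theorems.ImplosionDichotomyHsEosLowDensity
import Summits.AtomisticToContinuum.HydrodynamicLimit.Theorems.JParityClosureEvenStressEnskogL2ToProbability
import HarnessLib

/-!
# `EvenStressEnskog` at global equilibrium from the line's composition stubs restricted to constant profiles

Crux stmt-AtomisticToContinuum-13079 (`JParityClosure.EvenStressEnskog`), line `even-rung-mean-variance` (lead).  The registered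
skeleton `Lines/even-rung-mean-variance.lean` proves `EvenStressEnskog_of : S1 → S2 → S3 → S4 → EvenStressEnskog` (S5, S6 landed,
`HsEosLowDensity` a tree theorem).  Every one of S1–S4 is a local-equilibrium-type statement about the evolved local Gibbs law which is
open for general profiles at positive times; at RUNG 0 (constant profiles: the local Gibbs law is the flow-invariant canonical Gibbs
law) each reduces to statics of the canonical hard-sphere gas plus a Palm/collision-flux bound.  This file records the composition AT
RUNG 0: `EvenStressEnskog_rung0_of : S1|const → S2|const → S3|const → S4|const → EvenStressEnskog|const`, the same proof as
`EvenStressEnskog_of` specialised to constant profiles, so that the landed rung-0 reductions (`meanEnskogRung0_of_tubeMean`,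
`stub_velocityTruncationOfTails`, `stub_velocityTailEnergyRung0`, `stub_fixedTimeVarianceOfEvolved`, `stub_cylinderPullbackOfStar`, …)
compose into the crux at global equilibrium modulo the remaining named inputs.
-/

noncomputable section

open MeasureTheory Set Filter Topology Function
open scoped ENNReal NNReal BigOperators Topology InnerProductSpace

namespace Summit.AtomisticToContinuum.HydrodynamicLimit.Theorems.EvenStressEnskog

open Literature.Analysis.FluidPDE Literature.MathematicalPhysics.KineticTheory
open Summit.AtomisticToContinuum.HydrodynamicLimit.Theses.JParityClosure


/-! ## Vocabulary

The crux's `let`-chain, named, now lives in the tree: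
`Literature/MathematicalPhysics/KineticTheory/EvenCollisionTubeFunctional.lean` (p76472, 2026-08-16): `evenMark`,
`evenMarkTrunc` (+ `clip1`, `speedCutoff` and the truncation API `continuous_evenMarkTrunc`, `abs_evenMarkTrunc_le`,
`exists_abs_evenMarkTrunc_le`, `evenMarkTrunc_eq_zero_of_le`, `evenMarkTrunc_eq_evenMark`, `abs_evenMark_le`),
`coneKernel`, `mollDensity`, `sphereMark`, `pairFunctional`, `contactValue`, `enskogRate`, `collisionSum`
(`oddStatTrunc_one_eq_collisionSum`), `evenStat`, `evenTubeStat`, `evenTubeTimeStat` — bodies verbatim the former local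
definitions, so every registered stub text below is unchanged. -/

/-- **The crux `EvenStressEnskog` AT GLOBAL EQUILIBRIUM (rung 0: constant profiles `a, u, θ`) from the four composition stubs
of the line `even-rung-mean-variance` RESTRICTED TO CONSTANT PROFILES** — the same composition as the registered skeleton's
`EvenStressEnskog_of` (Lines/even-rung-mean-variance.lean), specialised: hypotheses are S1 `stub_velocityTruncation`, S2
`stub_cylinderPullback`, S3 `stub_meanEnskog`, S4 `stub_fixedTimeVariance` with `(a₀, u₀, θ₀)` constant; S5 (`stub_l2ToProbability`,
p76766) and S6 (`stub_evenTubeStatRegular`, p77220) are landed theorems and `HsEosLowDensity` is the tree's `hsEosLowDensity_proof`.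
Together with the landed rung-0 reductions (S3|const ⇐ H5 ∧ Contact: `meanEnskogRung0_of_tubeMean`; S1|const ⇐ (H_K)₀:
`stub_velocityTruncationOfTails` + `stub_velocityTailEnergyRung0`; S4|const and S2|const ⇐ static contact-scale cluster bounds) it
records exactly what the line still needs at equilibrium. -/
theorem EvenStressEnskog_rung0_of :
    (∃ η₀ : ℝ, 0 < η₀ ∧ ∀ (a θ : ℝ) (u : V3), 0 < a → 0 < θ → ∃ σ₀ : ℝ, 0 < σ₀ ∧ ∀ σ : ℝ, 0 < σ → σ < σ₀ →
      ∀ Φ : (N : ℕ) → HardSphereFlow (Torus.geometry (Fin 3)) (hsDiameter σ N) (N + 1),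
      ∀ τ : ℝ, 0 < τ → ∀ χ : ℝ × UnitAddTorus (Fin 3) → ℝ, Continuous χ → ∀ g : ℝ → ℝ, Continuous g →
      (∀ a, η₀ ≤ a → g a = 0) →
      ∀ η δ : ℝ, 0 < η → 0 < δ → ∃ r₀ : ℝ, 0 < r₀ ∧ ∀ r : ℝ, 0 < r → r < r₀ →
      ∃ L₀ : ℝ, ∀ L : ℝ, L₀ ≤ L → ∃ N₀ : ℕ, ∀ N : ℕ, N₀ ≤ N → ∀ k l : Fin 3,
        localGibbsLaw σ (fun _ => a) (fun _ => u) (fun _ => θ) N (Φ N)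
          {z | η < |evenStat σ N (Φ N) τ χ g (evenMark k l) r z -
              evenStat σ N (Φ N) τ χ g (evenMarkTrunc k l L) r z|}
          ≤ ENNReal.ofReal δ) →
    (∃ η₀ : ℝ, 0 < η₀ ∧ ∀ (a θ : ℝ) (u : V3), 0 < a → 0 < θ → ∃ σ₀ : ℝ, 0 < σ₀ ∧ ∀ σ : ℝ, 0 < σ → σ < σ₀ →
      ∀ Φ : (N : ℕ) → HardSphereFlow (Torus.geometry (Fin 3)) (hsDiameter σ N) (N + 1),
      ∀ τ : ℝ, 0 < τ → ∀ χ : ℝ × UnitAddTorus (Fin 3) → ℝ, Continuous χ → ∀ g : ℝ → ℝ, Continuous g →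
      (∀ a, η₀ ≤ a → g a = 0) →
      ∀ η δ : ℝ, 0 < η → 0 < δ → ∃ r₀ : ℝ, 0 < r₀ ∧ ∀ r : ℝ, 0 < r → r < r₀ →
      ∀ L : ℝ, 1 ≤ L → ∃ κ₀ : ℝ, 0 < κ₀ ∧ ∀ κ : ℝ, 0 < κ → κ < κ₀ → ∃ N₀ : ℕ, ∀ N : ℕ, N₀ ≤ N →
      ∀ k l : Fin 3,
        localGibbsLaw σ (fun _ => a) (fun _ => u) (fun _ => θ) N (Φ N)
          {z | η < |evenStat σ N (Φ N) τ χ g (evenMarkTrunc k l L) r z -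
              evenTubeTimeStat σ N (Φ N) τ χ g (evenMarkTrunc k l L) r κ z|}
          ≤ ENNReal.ofReal δ) →
    (∃ η₀ : ℝ, 0 < η₀ ∧ ∀ (a θ : ℝ) (u : V3), 0 < a → 0 < θ → ∃ σ₀ : ℝ, 0 < σ₀ ∧ ∀ σ : ℝ, 0 < σ → σ < σ₀ →
      ∀ Φ : (N : ℕ) → HardSphereFlow (Torus.geometry (Fin 3)) (hsDiameter σ N) (N + 1),
      ∀ τ : ℝ, 0 < τ → ∀ χ : ℝ × UnitAddTorus (Fin 3) → ℝ, Continuous χ → ∀ g : ℝ → ℝ, Continuous g →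
      (∀ a, η₀ ≤ a → g a = 0) →
      ∀ η : ℝ, 0 < η → ∃ r₀ : ℝ, 0 < r₀ ∧ ∀ r : ℝ, 0 < r → r < r₀ →
      ∀ L : ℝ, 1 ≤ L → ∃ κ₀ : ℝ, 0 < κ₀ ∧ ∀ κ : ℝ, 0 < κ → κ < κ₀ → ∃ N₀ : ℕ, ∀ N : ℕ, N₀ ≤ N →
      ∀ k l : Fin 3,
        |∫ t in Set.Icc (0 : ℝ) τ,
            ∫ z, evenTubeStat σ N χ g (evenMarkTrunc k l L) r κ t ((Φ N).flow t z)
              ∂(localGibbsLaw σ (fun _ => a) (fun _ => u) (fun _ => θ) N (Φ N))| ≤ η) →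
    (∃ η₀ : ℝ, 0 < η₀ ∧ ∀ (a θ : ℝ) (u : V3), 0 < a → 0 < θ → ∃ σ₀ : ℝ, 0 < σ₀ ∧ ∀ σ : ℝ, 0 < σ → σ < σ₀ →
      ∀ Φ : (N : ℕ) → HardSphereFlow (Torus.geometry (Fin 3)) (hsDiameter σ N) (N + 1),
      ∀ τ : ℝ, 0 < τ → ∀ χ : ℝ × UnitAddTorus (Fin 3) → ℝ, Continuous χ → ∀ g : ℝ → ℝ, Continuous g →
      (∀ a, η₀ ≤ a → g a = 0) →
      ∀ ς : ℝ, 0 < ς → ∃ r₀ : ℝ, 0 < r₀ ∧ ∀ r : ℝ, 0 < r → r < r₀ →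
      ∀ L κ : ℝ, 1 ≤ L → 0 < κ → κ ≤ 1 → ∃ N₀ : ℕ, ∀ N : ℕ, N₀ ≤ N → ∀ k l : Fin 3, ∀ t ∈ Set.Icc (0 : ℝ) τ,
        ProbabilityTheory.variance
          (fun z => evenTubeStat σ N χ g (evenMarkTrunc k l L) r κ t ((Φ N).flow t z))
          (localGibbsLaw σ (fun _ => a) (fun _ => u) (fun _ => θ) N (Φ N)) ≤ ς) →
    ∃ η₀ : ℝ, 0 < η₀ ∧ ∀ (a θ : ℝ) (u : V3), 0 < a → 0 < θ → ∃ σ₀ : ℝ, 0 < σ₀ ∧ ∀ σ : ℝ, 0 < σ → σ < σ₀ →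
      ∀ Φ : (N : ℕ) → HardSphereFlow (Torus.geometry (Fin 3)) (hsDiameter σ N) (N + 1),
      ∀ τ : ℝ, 0 < τ → ∀ χ : ℝ × UnitAddTorus (Fin 3) → ℝ, Continuous χ → ∀ g : ℝ → ℝ, Continuous g →
      (∀ a, η₀ ≤ a → g a = 0) →
      ∀ η δ : ℝ, 0 < η → 0 < δ → ∃ r₀ : ℝ, 0 < r₀ ∧ ∀ r : ℝ, 0 < r → r < r₀ →
      ∃ N₀ : ℕ, ∀ N : ℕ, N₀ ≤ N → ∀ k l : Fin 3,
        localGibbsLaw σ (fun _ => a) (fun _ => u) (fun _ => θ) N (Φ N) {z | η < |evenStat σ N (Φ N) τ χ g (evenMark k l) r z|}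
          ≤ ENNReal.ofReal δ := by
  have hS5 := @stub_l2ToProbability
  have hS6 := stub_evenTubeStatRegular
  intro hS1 hS2 hS3 hS4
  have hEos : HsEosLowDensity := Summit.AtomisticToContinuum.HydrodynamicLimit.Theorems.hsEosLowDensity_proof
  obtain ⟨η₁, hη₁, H1⟩ := hS1
  obtain ⟨η₂, hη₂, H2⟩ := hS2
  obtain ⟨η₃, hη₃, H3⟩ := hS3
  obtain ⟨η₄, hη₄, H4⟩ := hS4
  obtain ⟨η₆, hη₆, H6⟩ := hS6 hEos
  refine ⟨min (min (min η₁ η₂) (min η₃ η₄)) η₆,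
    lt_min (lt_min (lt_min hη₁ hη₂) (lt_min hη₃ hη₄)) hη₆, ?_⟩
  intro a θ u ha0 hθ0
  obtain ⟨σ₁, hσ₁, H1⟩ := H1 a θ u ha0 hθ0
  obtain ⟨σ₂, hσ₂, H2⟩ := H2 a θ u ha0 hθ0
  obtain ⟨σ₃, hσ₃, H3⟩ := H3 a θ u ha0 hθ0
  obtain ⟨σ₄, hσ₄, H4⟩ := H4 a θ u ha0 hθ0
  refine ⟨min (min (min σ₁ σ₂) (min σ₃ σ₄)) (1 / 2),
    lt_min (lt_min (lt_min hσ₁ hσ₂) (lt_min hσ₃ hσ₄)) (by norm_num), ?_⟩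
  intro σ hσ hσlt' Φ τ hτ χ hχ g hg hg0 η δ hη hδ
  have hσlt : σ < min (min σ₁ σ₂) (min σ₃ σ₄) := lt_of_lt_of_le hσlt' (min_le_left _ _)
  have hσhalf : σ ≤ 1 / 2 := (lt_of_lt_of_le hσlt' (min_le_right _ _)).le
  have hσ1 : σ < σ₁ := lt_of_lt_of_le hσlt ((min_le_left _ _).trans (min_le_left _ _))
  have hσ2 : σ < σ₂ := lt_of_lt_of_le hσlt ((min_le_left _ _).trans (min_le_right _ _))
  have hσ3 : σ < σ₃ := lt_of_lt_of_le hσlt ((min_le_right _ _).trans (min_le_left _ _))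
  have hσ4 : σ < σ₄ := lt_of_lt_of_le hσlt ((min_le_right _ _).trans (min_le_right _ _))
  -- the cutoff vanishes above each threshold
  have hmin₁ : min (min (min η₁ η₂) (min η₃ η₄)) η₆ ≤ η₁ :=
    ((min_le_left _ _).trans (min_le_left _ _)).trans (min_le_left _ _)
  have hmin₂ : min (min (min η₁ η₂) (min η₃ η₄)) η₆ ≤ η₂ :=
    ((min_le_left _ _).trans (min_le_left _ _)).trans (min_le_right _ _)
  have hmin₃ : min (min (min η₁ η₂) (min η₃ η₄)) η₆ ≤ η₃ :=
    ((min_le_left _ _).trans (min_le_right _ _)).trans (min_le_left _ _)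
  have hmin₄ : min (min (min η₁ η₂) (min η₃ η₄)) η₆ ≤ η₄ :=
    ((min_le_left _ _).trans (min_le_right _ _)).trans (min_le_right _ _)
  have hmin₆ : min (min (min η₁ η₂) (min η₃ η₄)) η₆ ≤ η₆ := min_le_right _ _
  have hg1 : ∀ a, η₁ ≤ a → g a = 0 := fun a h => hg0 a (hmin₁.trans h)
  have hg2 : ∀ a, η₂ ≤ a → g a = 0 := fun a h => hg0 a (hmin₂.trans h)
  have hg3 : ∀ a, η₃ ≤ a → g a = 0 := fun a h => hg0 a (hmin₃.trans h)
  have hg4 : ∀ a, η₄ ≤ a → g a = 0 := fun a h => hg0 a (hmin₄.trans h)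
  have hg6 : ∀ a, η₆ ≤ a → g a = 0 := fun a h => hg0 a (hmin₆.trans h)
  -- accuracies
  have hη3 : 0 < η / 3 := by positivity
  have hδ3 : 0 < δ / 3 := by positivity
  have hη6 : 0 < η / 6 := by positivity
  have hς : 0 < δ / 3 * (η / 6) ^ 2 / τ ^ 2 := by positivity
  obtain ⟨r₁, hr₁, H1⟩ := H1 σ hσ hσ1 Φ τ hτ χ hχ g hg hg1 (η / 3) (δ / 3) hη3 hδ3
  obtain ⟨r₂, hr₂, H2⟩ := H2 σ hσ hσ2 Φ τ hτ χ hχ g hg hg2 (η / 3) (δ / 3) hη3 hδ3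
  obtain ⟨r₃, hr₃, H3⟩ := H3 σ hσ hσ3 Φ τ hτ χ hχ g hg hg3 (η / 6) hη6
  obtain ⟨r₄, hr₄, H4⟩ := H4 σ hσ hσ4 Φ τ hτ χ hχ g hg hg4 (δ / 3 * (η / 6) ^ 2 / τ ^ 2) hς
  refine ⟨min (min r₁ r₂) (min r₃ r₄), lt_min (lt_min hr₁ hr₂) (lt_min hr₃ hr₄), ?_⟩
  intro r hr hrlt
  have hr1 : r < r₁ := lt_of_lt_of_le hrlt ((min_le_left _ _).trans (min_le_left _ _))
  have hr2 : r < r₂ := lt_of_lt_of_le hrlt ((min_le_left _ _).trans (min_le_right _ _))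
  have hr3 : r < r₃ := lt_of_lt_of_le hrlt ((min_le_right _ _).trans (min_le_left _ _))
  have hr4 : r < r₄ := lt_of_lt_of_le hrlt ((min_le_right _ _).trans (min_le_right _ _))
  -- truncation level (S1)
  obtain ⟨L₀, H1⟩ := H1 r hr hr1
  have hL₀ : L₀ ≤ max L₀ 1 := le_max_left _ _
  have hL1 : (1 : ℝ) ≤ max L₀ 1 := le_max_right _ _
  have hL0 : (0 : ℝ) ≤ max L₀ 1 := zero_le_one.trans hL1
  obtain ⟨N₁, H1⟩ := H1 (max L₀ 1) hL₀
  -- flight-time window (S2 and S3 each give a κ₀)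
  obtain ⟨κ₂, hκ₂, H2⟩ := H2 r hr hr2 (max L₀ 1) hL1
  obtain ⟨κ₃, hκ₃, H3⟩ := H3 r hr hr3 (max L₀ 1) hL1
  have hκpos : (0 : ℝ) < min (min (κ₂ / 2) (κ₃ / 2)) 1 := lt_min (lt_min (by positivity) (by positivity)) one_pos
  have hκlt2 : min (min (κ₂ / 2) (κ₃ / 2)) 1 < κ₂ :=
    lt_of_le_of_lt ((min_le_left _ _).trans (min_le_left _ _)) (by linarith)
  have hκlt3 : min (min (κ₂ / 2) (κ₃ / 2)) 1 < κ₃ :=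
    lt_of_le_of_lt ((min_le_left _ _).trans (min_le_right _ _)) (by linarith)
  have hκ1 : min (min (κ₂ / 2) (κ₃ / 2)) 1 ≤ (1 : ℝ) := min_le_right _ _
  obtain ⟨N₂, H2⟩ := H2 (min (min (κ₂ / 2) (κ₃ / 2)) 1) hκpos hκlt2
  obtain ⟨N₃, H3⟩ := H3 (min (min (κ₂ / 2) (κ₃ / 2)) 1) hκpos hκlt3
  obtain ⟨N₄, H4⟩ := H4 r hr hr4 (max L₀ 1) (min (min (κ₂ / 2) (κ₃ / 2)) 1) hL1 hκpos hκ1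
  refine ⟨max (max N₁ N₂) (max N₃ N₄), fun N hN => ?_⟩
  intro k l
  have hN1 : N₁ ≤ N := ((le_max_left _ _).trans (le_max_left _ _)).trans hN
  have hN2 : N₂ ≤ N := ((le_max_right _ _).trans (le_max_left _ _)).trans hN
  have hN3 : N₃ ≤ N := ((le_max_left _ _).trans (le_max_right _ _)).trans hN
  have hN4 : N₄ ≤ N := ((le_max_right _ _).trans (le_max_right _ _)).trans hN
  have E1 := H1 N hN1 k l
  have E2 := H2 N hN2 k l
  have E3 := H3 N hN3 k l
  have E4 : ∀ t ∈ Set.Icc (0 : ℝ) τ,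
      ProbabilityTheory.variance
        (fun z => evenTubeStat σ N χ g (evenMarkTrunc k l (max L₀ 1)) r (min (min (κ₂ / 2) (κ₃ / 2)) 1) t
          ((Φ N).flow t z))
        (localGibbsLaw σ (fun _ => a) (fun _ => u) (fun _ => θ) N (Φ N)) ≤ δ / 3 * (η / 6) ^ 2 / τ ^ 2 :=
    fun t ht => H4 N hN4 k l t ht
  -- regularity of W (S6) and the probability law, fed into S5
  obtain ⟨hmeas, B, hB⟩ := H6 σ N χ g k l (max L₀ 1) r (min (min (κ₂ / 2) (κ₃ / 2)) 1) τ hσ hχ hg hg6 hL0 hr hκpos.le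
  have hPN : IsProbabilityMeasure (localGibbsLaw σ (fun _ => a) (fun _ => u) (fun _ => θ) N (Φ N)) :=
    isProbabilityMeasure_localGibbsLaw continuous_const continuous_const continuous_const (fun _ => ha0) (fun _ => hθ0) hσhalf N (Φ N)
  have E5 := hS5 σ (fun _ => a) (fun _ => θ) (fun _ => u) N (Φ N) τ
    (fun t z => evenTubeStat σ N χ g (evenMarkTrunc k l (max L₀ 1)) r (min (min (κ₂ / 2) (κ₃ / 2)) 1) t z)
    (η / 6) (δ / 3 * (η / 6) ^ 2 / τ ^ 2) (η / 3) B hPN hmeas hB hτ hς.le (by linarith) E3 E4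
  have hval : τ ^ 2 * (δ / 3 * (η / 6) ^ 2 / τ ^ 2) / (η / 3 - η / 6) ^ 2 = δ / 3 := by
    field_simp
    ring
  rw [hval] at E5
  -- the union bound
  set P := localGibbsLaw σ (fun _ => a) (fun _ => u) (fun _ => θ) N (Φ N) with hP
  set D := fun z => evenStat σ N (Φ N) τ χ g (evenMark k l) r z with hD
  set DL := fun z => evenStat σ N (Φ N) τ χ g (evenMarkTrunc k l (max L₀ 1)) r z with hDL
  set T := fun z => evenTubeTimeStat σ N (Φ N) τ χ g (evenMarkTrunc k l (max L₀ 1)) r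
    (min (min (κ₂ / 2) (κ₃ / 2)) 1) z with hT
  have E5' : P {z | η / 3 < |T z|} ≤ ENNReal.ofReal (δ / 3) := E5
  have hsub : {z | η < |D z|} ⊆
      ({z | η / 3 < |D z - DL z|} ∪ {z | η / 3 < |DL z - T z|}) ∪ {z | η / 3 < |T z|} := by
    intro z hz
    simp only [Set.mem_setOf_eq, Set.mem_union] at hz ⊢
    by_contra hcon
    simp only [not_or, not_lt] at hcon
    obtain ⟨⟨h1, h2⟩, h3⟩ := hcon
    have i1 := abs_sub_abs_le_abs_sub (D z) (DL z)
    have i2 := abs_sub_abs_le_abs_sub (DL z) (T z)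
    linarith
  calc P {z | η < |D z|}
      ≤ P (({z | η / 3 < |D z - DL z|} ∪ {z | η / 3 < |DL z - T z|}) ∪ {z | η / 3 < |T z|}) :=
        measure_mono hsub
    _ ≤ P ({z | η / 3 < |D z - DL z|} ∪ {z | η / 3 < |DL z - T z|}) + P {z | η / 3 < |T z|} :=
        measure_union_le _ _
    _ ≤ (P {z | η / 3 < |D z - DL z|} + P {z | η / 3 < |DL z - T z|}) + P {z | η / 3 < |T z|} :=
        add_le_add (measure_union_le _ _) le_rfl
    _ ≤ (ENNReal.ofReal (δ / 3) + ENNReal.ofReal (δ / 3)) + ENNReal.ofReal (δ / 3) :=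
        add_le_add (add_le_add E1 E2) E5'
    _ = ENNReal.ofReal δ := by
        rw [← ENNReal.ofReal_add hδ3.le hδ3.le, ← ENNReal.ofReal_add (by positivity) hδ3.le]
        congr 1
        ring

end Summit.AtomisticToContinuum.HydrodynamicLimit.Theorems.EvenStressEnskog

end
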